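import Literature.NumberTheory.LFunctions.ExplicitFormulaPsiOne
import Literature.NumberTheory.LFunctions.RieszMeanDirichlet
import Literature.NumberTheory.LFunctions.NicolasFz
import Mathlib.MeasureTheory.Integral.IntervalIntegral.IntegrationByParts
import HarnessLib

/-!
# Nicolas's integral `J(x) = ∫_x^∞ (ψ(t) − t) t^{−2}(1/log t + 1/log² t) dt`: the calculus

Topic: `Literature/NumberTheory/LFunctions`. THEOREMS (everything proved). J.-L. Nicolas, Acta Arith.
155 (2012), (1.16): `J(x) = ∫_x^∞ R(t)/t² (1/log t + 1/log² t) dt`, `R = ψ − t`, the integral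
through which the explicit formula enters his RH-explicit Mertens bound (Lemma 2.5, hence (2.18) =
`Nicolas2012_logf_lower_sharp`, `NicolasMertensRH.lean`). This file supplies the real-variable
calculus that turns `J` into an absolutely convergent expression in the Riesz mean
`ψ₁(t) = ∑_{n ≤ t} Λ(n)(t − n)` (`Literature.NumberTheory.LFunctions.psiOne`, `ExplicitFormulaPsiOne.lean`), to which the
explicit formula applies (`NicolasJExplicit.lean`, the sibling):

* `ψ₁` is continuous, piecewise linear, with right derivative `ψ` everywhere
  (`hasDerivWithinAt_psiOne`; `psiOne_sub_psiOne`), so `∫_a^b ψ = ψ₁(b) − ψ₁(a)`;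
* the weight `w₀(t) = (1/log t + 1/log² t)/t² = −(d/dt) (1/(t log t))` (`hasDerivAt_inv_mul_log`),
  its derivative `w₀'(t) = −(2/log t + 3/log² t + 2/log³ t)/t³ < 0` (`hasDerivAt_w0`), and
  `∫_x^∞ w₀ = 1/(x log x)` (`integral_w0`);
* integration by parts with `R₁ = ψ₁ − t²/2` (right derivative `R`):
  `∫_x^X R w₀ = R₁(X) w₀(X) − R₁(x) w₀(x) − ∫_x^X R₁ w₀'` (`integral_R_mul_w0_eq`);
* if `|R₁(t)| ≤ C t^{3/2}` for `t ≥ x` (under RH this is the explicit formula,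
  `Literature.NumberTheory.LFunctions.norm_psiOne_sub_le_of_RH`), then `∫_x^X R w₀ → J(x)` as `X → ∞`, where
  `J(x) := −R₁(x) w₀(x) − ∫_x^∞ R₁ w₀'` converges absolutely (`nicolasJ`, `tendsto_integral_R_mul_w0`):
  the improper integral (1.16) exists and equals `nicolasJ x`.

## References

* J.-L. Nicolas, *Small values of the Euler function and the Riemann hypothesis*, Acta Arith. 155
  (2012), 311–321 (arXiv:1202.0729), (1.15)–(1.16), Lemma 2.5. [Nicolas2012]
* J.-L. Nicolas, *Petites valeurs de la fonction d'Euler*, J. Number Theory 17 (1983), 375–388,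
  §2 (the integrals `J`, `K`). [Nicolas1983]
-/

noncomputable section

open Filter Set MeasureTheory Topology intervalIntegral
open scoped Real Chebyshev

namespace Literature.NumberTheory.LFunctions

namespace NicolasJ

/-! ### `ψ₁`: piecewise linear, right derivative `ψ` -/

/-- `ψ` is the summatory function of `Λ` with the same index set as `ψ₁`. [folklore] -/
theorem psi_eq_sum (x : ℝ) :
    ψ x = ∑ n ∈ Finset.Ioc 0 ⌊x⌋₊, (ArithmeticFunction.vonMangoldt n : ℝ) := rfl

/-- **`ψ₁(y) − ψ₁(x) = (y − x) ψ(x) + ∑_{x < n ≤ y} Λ(n)(y − n)`** for `x ≤ y`.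
[cite: Nicolas2012, (1.16) (the Riesz mean behind `J`)] -/
theorem psiOne_sub_psiOne {x y : ℝ} (hxy : x ≤ y) :
    psiOne y - psiOne x = (y - x) * ψ x +
      ∑ n ∈ Finset.Ioc ⌊x⌋₊ ⌊y⌋₊, (ArithmeticFunction.vonMangoldt n : ℝ) * (y - n) :=
  RieszMean.rieszMean_sub_rieszMean_eq (fun n ↦ (ArithmeticFunction.vonMangoldt n : ℝ)) hxy

/-- On an interval without integers `ψ₁` is affine: if `x ≤ y` and `⌊y⌋ = ⌊x⌋` then
`ψ₁(y) = ψ₁(x) + (y − x) ψ(x)`. [folklore] -/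
theorem psiOne_eq_of_floor_eq {x y : ℝ} (hxy : x ≤ y) (hfl : ⌊y⌋₊ = ⌊x⌋₊) :
    psiOne y = psiOne x + (y - x) * ψ x := by
  have h := psiOne_sub_psiOne hxy
  rw [hfl, Finset.Ioc_self, Finset.sum_empty, add_zero] at h
  linarith

/-- `0 ≤ ψ₁(y) − ψ₁(x) ≤ (y − x) ψ(y)` for `x ≤ y` (Landau's differencing inequalities).
[folklore] -/
theorem psiOne_sub_psiOne_bounds {x y : ℝ} (hxy : x ≤ y) :
    0 ≤ psiOne y - psiOne x ∧ psiOne y - psiOne x ≤ (y - x) * ψ y := by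
  have hΛ : ∀ n : ℕ, (0 : ℝ) ≤ ArithmeticFunction.vonMangoldt n := fun n ↦
    ArithmeticFunction.vonMangoldt_nonneg
  constructor
  · rw [psiOne_sub_psiOne hxy]
    refine add_nonneg (mul_nonneg (by linarith) (Chebyshev.psi_nonneg x)) (Finset.sum_nonneg fun n hn ↦
      mul_nonneg (hΛ n) ?_)
    rw [Finset.mem_Ioc] at hn
    rcases le_or_gt 0 y with hy | hy
    · have : (n : ℝ) ≤ y := (Nat.cast_le.2 hn.2).trans (Nat.floor_le hy)
      linarith
    · have : ⌊y⌋₊ = 0 := Nat.floor_eq_zero.2 (by linarith)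
      omega
  · exact RieszMean.sub_le_sub_mul_sum hΛ hxy

/-- `ψ₁` is Lipschitz on `(−∞, B]` with constant `ψ(B)`. [folklore] -/
theorem abs_psiOne_sub_psiOne_le {x y B : ℝ} (hx : x ≤ B) (hy : y ≤ B) :
    |psiOne y - psiOne x| ≤ ψ B * |y - x| := by
  wlog hxy : x ≤ y generalizing x y
  · have := this hy hx (le_of_not_ge hxy)
    rwa [abs_sub_comm, abs_sub_comm x y] at this
  obtain ⟨h0, h1⟩ := psiOne_sub_psiOne_bounds hxy
  rw [abs_of_nonneg h0, abs_of_nonneg (by linarith)]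
  calc psiOne y - psiOne x ≤ (y - x) * ψ y := h1
    _ ≤ (y - x) * ψ B := mul_le_mul_of_nonneg_left (Chebyshev.psi_mono hy) (by linarith)
    _ = ψ B * (y - x) := mul_comm _ _

/-- **`ψ₁` is continuous.** [folklore] -/
theorem continuous_psiOne : Continuous psiOne := by
  refine continuous_iff_continuousAt.2 fun x ↦ ?_
  have hL : LipschitzOnWith ⟨ψ (x + 1), Chebyshev.psi_nonneg _⟩ psiOne (Iio (x + 1)) := by
    refine LipschitzOnWith.of_dist_le_mul fun y hy z hz ↦ ?_
    rw [dist_eq_norm, dist_eq_norm, Real.norm_eq_abs, Real.norm_eq_abs]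
    exact abs_psiOne_sub_psiOne_le (le_of_lt hz) (le_of_lt hy)
  exact hL.continuousOn.continuousAt (Iio_mem_nhds (by linarith))

/-- **The right derivative of `ψ₁` is `ψ`**, at every real `x`. [folklore] -/
theorem hasDerivWithinAt_psiOne (x : ℝ) : HasDerivWithinAt psiOne (ψ x) (Ioi x) x := by
  -- the affine function that `ψ₁` agrees with on `[x, ⌊x⌋₊ + 1)` (or on `[x, 0)` ∪ … for `x < 0`)
  have haff : HasDerivWithinAt (fun y : ℝ ↦ psiOne x + (y - x) * ψ x) (ψ x) (Ioi x) x := by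
    have := ((hasDerivAt_id x).sub_const x).mul_const (ψ x)
    simpa using (this.const_add (psiOne x)).hasDerivWithinAt
  refine haff.congr_of_eventuallyEq ?_ (by simp)
  -- right-neighbourhood on which the floor is constant
  rcases lt_or_ge x 0 with hx | hx
  · -- `x < 0`: `ψ₁ = 0 = ψ` near `x`
    filter_upwards [Ioo_mem_nhdsGT hx] with y hy
    have hy0 : ⌊y⌋₊ = 0 := Nat.floor_eq_zero.2 (by linarith [hy.2])
    have hx0 : ⌊x⌋₊ = 0 := Nat.floor_eq_zero.2 (by linarith)
    exact psiOne_eq_of_floor_eq hy.1.le (by rw [hy0, hx0])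
  · have hlt : x < ⌊x⌋₊ + 1 := Nat.lt_floor_add_one x
    filter_upwards [Ioo_mem_nhdsGT hlt] with y hy
    refine psiOne_eq_of_floor_eq hy.1.le ?_
    rw [Nat.floor_eq_iff (hx.trans hy.1.le)]
    exact ⟨(Nat.floor_le hx).trans hy.1.le, hy.2⟩

/-- `ψ` is interval integrable (it is monotone). [folklore] -/
theorem intervalIntegrable_psi (a b : ℝ) : IntervalIntegrable ψ volume a b :=
  Chebyshev.psi_mono.intervalIntegrable

/-- **`∫_a^b ψ(t) dt = ψ₁(b) − ψ₁(a)`.** [folklore] -/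
theorem integral_psi (a b : ℝ) : ∫ t in a..b, ψ t = psiOne b - psiOne a :=
  integral_eq_sub_of_hasDeriv_right continuous_psiOne.continuousOn
    (fun x _ ↦ hasDerivWithinAt_psiOne x) (intervalIntegrable_psi a b)

/-! ### The weight `w₀(t) = (1/log t + 1/log² t)/t²` -/

/-- Nicolas's weight `w₀(t) = (1/log t + 1/log² t)/t²` (the kernel of `J` and `K`, (1.15)–(1.16)).
[cite: Nicolas2012, (1.15)–(1.16)] -/
def w0 (t : ℝ) : ℝ := NicolasFz.wt t / t ^ 2

/-- The derivative `w₀'(t) = −(2/log t + 3/log² t + 2/log³ t)/t³`. [folklore] -/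
def w0' (t : ℝ) : ℝ := -(2 / Real.log t + 3 / Real.log t ^ 2 + 2 / Real.log t ^ 3) / t ^ 3

/-- `w₀ > 0` on `(1, ∞)`. [folklore] -/
theorem w0_pos {t : ℝ} (ht : 1 < t) : 0 < w0 t := by
  have : 0 < Real.log t := Real.log_pos ht
  have : 0 < t := by linarith
  unfold w0 NicolasFz.wt
  positivity

/-- `w₀' < 0` on `(1, ∞)`. [folklore] -/
theorem w0'_neg {t : ℝ} (ht : 1 < t) : w0' t < 0 := by
  have : 0 < Real.log t := Real.log_pos ht
  have : 0 < t := by linarith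
  unfold w0'
  rw [neg_div, neg_lt_zero]
  positivity

/-- **`(d/dt) (1/(t log t)) = −w₀(t)`** for `t > 1`. [cite: Nicolas2012, (1.15)–(1.16)] -/
theorem hasDerivAt_inv_mul_log {t : ℝ} (ht : 1 < t) :
    HasDerivAt (fun u : ℝ ↦ 1 / (u * Real.log u)) (-w0 t) t := by
  have ht0 : t ≠ 0 := by linarith
  have hlog : Real.log t ≠ 0 := (Real.log_pos ht).ne'
  have h1 : HasDerivAt (fun u : ℝ ↦ u * Real.log u) (1 * Real.log t + t * t⁻¹) t :=
    (hasDerivAt_id t).mul (Real.hasDerivAt_log ht0)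
  have h2 : HasDerivAt (fun u : ℝ ↦ (u * Real.log u)⁻¹)
      (-(1 * Real.log t + t * t⁻¹) / (t * Real.log t) ^ 2) t := h1.inv (mul_ne_zero ht0 hlog)
  have h3 : HasDerivAt (fun u : ℝ ↦ 1 / (u * Real.log u))
      (-(1 * Real.log t + t * t⁻¹) / (t * Real.log t) ^ 2) t := by
    have hfun : (fun u : ℝ ↦ 1 / (u * Real.log u)) = fun u : ℝ ↦ (u * Real.log u)⁻¹ := by
      funext u; rw [one_div]
    rw [hfun]; exact h2
  refine h3.congr_deriv ?_
  unfold w0 NicolasFz.wt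
  field_simp

/-- **`w₀` is differentiable on `(1, ∞)` with derivative `w₀'`.** [folklore] -/
theorem hasDerivAt_w0 {t : ℝ} (ht : 1 < t) : HasDerivAt w0 (w0' t) t := by
  have ht0 : t ≠ 0 := by linarith
  have hlog : Real.log t ≠ 0 := (Real.log_pos ht).ne'
  have hl := Real.hasDerivAt_log ht0
  have h1 : HasDerivAt (fun u : ℝ ↦ (Real.log u)⁻¹) (-(t⁻¹) / Real.log t ^ 2) t := hl.inv hlog
  have h2 : HasDerivAt (fun u : ℝ ↦ (Real.log u ^ 2)⁻¹)
      (-(((2 : ℕ) : ℝ) * Real.log t ^ (2 - 1) * t⁻¹) / (Real.log t ^ 2) ^ 2) t :=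
    (hl.pow 2).inv (pow_ne_zero _ hlog)
  have h3 : HasDerivAt (fun u : ℝ ↦ (u ^ 2)⁻¹) (-(((2 : ℕ) : ℝ) * t ^ (2 - 1)) / (t ^ 2) ^ 2) t :=
    (hasDerivAt_pow 2 t).inv (pow_ne_zero _ ht0)
  have h4 := (h1.add h2).mul h3
  have hfun : w0 = fun u : ℝ ↦ ((Real.log u)⁻¹ + (Real.log u ^ 2)⁻¹) * (u ^ 2)⁻¹ := by
    funext u
    simp only [w0, NicolasFz.wt, div_eq_mul_inv, one_mul]
  rw [hfun]
  refine h4.congr_deriv ?_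
  simp only [Pi.add_apply]
  unfold w0'
  push_cast
  field_simp
  ring

/-- `w₀` is continuous on `(1, ∞)`. [folklore] -/
theorem continuousOn_w0 : ContinuousOn w0 (Ioi 1) := fun _ ht ↦
  (hasDerivAt_w0 ht).continuousAt.continuousWithinAt

/-- `w₀'` is continuous on `(1, ∞)`. [folklore] -/
theorem continuousOn_w0' : ContinuousOn w0' (Ioi 1) := by
  unfold w0'
  refine ContinuousOn.div (ContinuousOn.neg ?_) (continuousOn_id.pow 3) fun t ht ↦
    pow_ne_zero _ (by linarith [mem_Ioi.1 ht])
  have hlog : ContinuousOn Real.log (Ioi 1) := Real.continuousOn_log.mono fun t ht ↦ by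
    simp; linarith [mem_Ioi.1 ht]
  have hne : ∀ t ∈ Ioi (1 : ℝ), Real.log t ≠ 0 := fun t ht ↦ (Real.log_pos ht).ne'
  refine ((continuousOn_const.div hlog hne).add (continuousOn_const.div (hlog.pow 2) fun t ht ↦
    pow_ne_zero _ (hne t ht))).add (continuousOn_const.div (hlog.pow 3) fun t ht ↦
    pow_ne_zero _ (hne t ht))

/-- `w₀(t) ≤ (1/log x + 1/log² x)/t²` for `t ≥ x > 1`. [folklore] -/
theorem w0_le {x t : ℝ} (hx : 1 < x) (ht : x ≤ t) :
    w0 t ≤ (1 / Real.log x + 1 / Real.log x ^ 2) / t ^ 2 := by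
  have hlx : 0 < Real.log x := Real.log_pos hx
  have hlt : Real.log x ≤ Real.log t := Real.log_le_log (by linarith) ht
  have ht0 : 0 < t := by linarith
  unfold w0 NicolasFz.wt
  refine div_le_div_of_nonneg_right (add_le_add ?_ ?_) (by positivity)
  · exact one_div_le_one_div_of_le hlx hlt
  · exact one_div_le_one_div_of_le (by positivity) (pow_le_pow_left₀ hlx.le hlt 2)

/-- `|w₀'(t)| ≤ (2/log x + 3/log² x + 2/log³ x)/t³` for `t ≥ x > 1`. [folklore] -/
theorem abs_w0'_le {x t : ℝ} (hx : 1 < x) (ht : x ≤ t) :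
    |w0' t| ≤ (2 / Real.log x + 3 / Real.log x ^ 2 + 2 / Real.log x ^ 3) / t ^ 3 := by
  have hlx : 0 < Real.log x := Real.log_pos hx
  have hlt : Real.log x ≤ Real.log t := Real.log_le_log (by linarith) ht
  have hlt0 : 0 < Real.log t := hlx.trans_le hlt
  have ht0 : 0 < t := by linarith
  unfold w0'
  rw [abs_div, abs_neg, abs_of_pos (by positivity), abs_of_pos (by positivity)]
  refine div_le_div_of_nonneg_right (add_le_add (add_le_add ?_ ?_) ?_) (by positivity)
  · exact div_le_div_of_nonneg_left (by norm_num) hlx hlt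
  · exact div_le_div_of_nonneg_left (by norm_num) (by positivity) (pow_le_pow_left₀ hlx.le hlt 2)
  · exact div_le_div_of_nonneg_left (by norm_num) (by positivity) (pow_le_pow_left₀ hlx.le hlt 3)

/-- **`∫_x^∞ w₀ = 1/(x log x)`** (`x > 1`). [cite: Nicolas2012, (1.15)–(1.16)] -/
theorem integral_w0 {x : ℝ} (hx : 1 < x) : ∫ t in Ioi x, w0 t = 1 / (x * Real.log x) := by
  have hx0 : 0 < x := by linarith
  have hderiv : ∀ t ∈ Ici x, HasDerivAt (fun u : ℝ ↦ -(1 / (u * Real.log u))) (w0 t) t := by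
    intro t ht
    have h := (hasDerivAt_inv_mul_log (hx.trans_le ht)).neg
    rw [neg_neg] at h
    exact h
  have hint : IntegrableOn w0 (Ioi x) := by
    have hb : IntegrableOn (fun t : ℝ ↦ (1 / Real.log x + 1 / Real.log x ^ 2) * t ^ (-2 : ℝ)) (Ioi x) :=
      (integrableOn_Ioi_rpow_of_lt (by norm_num) hx0).const_mul _
    refine hb.mono' ((continuousOn_w0.mono fun t ht ↦ hx.trans ht).aestronglyMeasurable
      measurableSet_Ioi) ((ae_restrict_iff' measurableSet_Ioi).2 (ae_of_all _ fun t ht ↦ ?_))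
    have ht0 : 0 < t := hx0.trans ht
    rw [Real.norm_eq_abs, abs_of_pos (w0_pos (hx.trans ht)), Real.rpow_neg ht0.le,
      show (t ^ (2 : ℝ)) = t ^ 2 by norm_cast, ← div_eq_mul_inv]
    exact w0_le hx ht.le
  have hlim : Tendsto (fun u : ℝ ↦ -(1 / (u * Real.log u))) atTop (𝓝 0) := by
    have h1 : Tendsto (fun u : ℝ ↦ u * Real.log u) atTop atTop :=
      Tendsto.atTop_mul_atTop₀ tendsto_id Real.tendsto_log_atTop
    have h2 : Tendsto (fun u : ℝ ↦ 1 / (u * Real.log u)) atTop (𝓝 0) := by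
      have hfun : (fun u : ℝ ↦ 1 / (u * Real.log u)) = fun u : ℝ ↦ (u * Real.log u)⁻¹ := by
        funext u; rw [one_div]
      rw [hfun]; exact h1.inv_tendsto_atTop
    simpa using h2.neg
  have := integral_Ioi_of_hasDerivAt_of_tendsto' hderiv hint hlim
  rw [this]
  ring

/-! ### Integration by parts for `∫_x^X R w₀` -/

/-- `R₁(t) = ψ₁(t) − t²/2`, an antiderivative (from the right) of `R(t) = ψ(t) − t`.
[cite: Nicolas2012, (1.16) with (13.6) of Montgomery–Vaughan] -/
def Rone (t : ℝ) : ℝ := psiOne t - t ^ 2 / 2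

/-- The right derivative of `R₁` is `R = ψ − t`. [folklore] -/
theorem hasDerivWithinAt_Rone (t : ℝ) : HasDerivWithinAt Rone (ψ t - t) (Ioi t) t := by
  have h2 : HasDerivAt (fun u : ℝ ↦ u ^ 2 / 2) t t := by
    have := (hasDerivAt_pow 2 t).div_const 2
    simpa using this
  exact (hasDerivWithinAt_psiOne t).sub h2.hasDerivWithinAt

/-- `R₁` is continuous. [folklore] -/
theorem continuous_Rone : Continuous Rone :=
  continuous_psiOne.sub ((continuous_pow 2).div_const 2)

/-- **Integration by parts**: for `1 < x ≤ X`,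
`∫_x^X (ψ(t) − t) w₀(t) dt = R₁(X) w₀(X) − R₁(x) w₀(x) − ∫_x^X R₁(t) w₀'(t) dt`.
[cite: Nicolas2012, Lemma 2.5 (proof, via Nicolas1983 §2)] -/
theorem integral_R_mul_w0_eq {x X : ℝ} (hx : 1 < x) (hxX : x ≤ X) :
    ∫ t in x..X, (ψ t - t) * w0 t = Rone X * w0 X - Rone x * w0 x - ∫ t in x..X, Rone t * w0' t := by
  have hIcc : uIcc x X = Icc x X := uIcc_of_le hxX
  have hw0c : ContinuousOn w0 (uIcc x X) := by
    rw [hIcc]; exact continuousOn_w0.mono fun t ht ↦ hx.trans_le ht.1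
  have hw0'c : ContinuousOn w0' (uIcc x X) := by
    rw [hIcc]; exact continuousOn_w0'.mono fun t ht ↦ hx.trans_le ht.1
  have h := integral_deriv_mul_eq_sub_of_hasDeriv_right (u := Rone) (v := w0) (u' := fun t ↦ ψ t - t)
    (v' := w0') (a := x) (b := X) continuous_Rone.continuousOn hw0c
    (fun t _ ↦ hasDerivWithinAt_Rone t)
    (fun t ht ↦ (hasDerivAt_w0 (by rw [min_eq_left hxX] at ht; exact hx.trans ht.1)).hasDerivWithinAt)
    ((intervalIntegrable_psi x X).sub intervalIntegrable_id) (hw0'c.intervalIntegrable)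
  have hi1 : IntervalIntegrable (fun t ↦ (ψ t - t) * w0 t) volume x X :=
    ((intervalIntegrable_psi x X).sub intervalIntegrable_id).mul_continuousOn hw0c
  have hi2 : IntervalIntegrable (fun t ↦ Rone t * w0' t) volume x X :=
    hw0'c.intervalIntegrable.continuousOn_mul continuous_Rone.continuousOn
  rw [integral_add hi1 hi2] at h
  linarith

/-! ### `J(x)` as an absolutely convergent expression -/

/-- **Nicolas's `J(x)`**, written in its absolutely convergent form
`J(x) = −R₁(x) w₀(x) − ∫_x^∞ R₁(t) w₀'(t) dt` (`R₁ = ψ₁ − t²/2`); by `tendsto_integral_R_mul_w0` this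
is the improper integral `∫_x^∞ (ψ(t) − t) t^{−2}(1/log t + 1/log²t) dt` of (1.16) whenever
`R₁(t) = O(t^{3/2})` (e.g. under RH). [cite: Nicolas2012, (1.16)] -/
def nicolasJ (x : ℝ) : ℝ := -Rone x * w0 x - ∫ t in Ioi x, Rone t * w0' t

/-- Under `|R₁(t)| ≤ C t^{3/2}` (`t ≥ x > 1`), `R₁ w₀'` is integrable on `(x, ∞)`. [folklore] -/
theorem integrableOn_Rone_mul_w0' {x C : ℝ} (hx : 1 < x) (hC : ∀ t, x ≤ t → |Rone t| ≤ C * t ^ (3 / 2 : ℝ)) :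
    IntegrableOn (fun t ↦ Rone t * w0' t) (Ioi x) := by
  have hx0 : 0 < x := by linarith
  set M : ℝ := 2 / Real.log x + 3 / Real.log x ^ 2 + 2 / Real.log x ^ 3 with hM
  have hC0 : 0 ≤ C := by
    have := hC x le_rfl
    have h1 : 0 < x ^ (3 / 2 : ℝ) := Real.rpow_pos_of_pos hx0 _
    nlinarith [abs_nonneg (Rone x)]
  have hb : IntegrableOn (fun t : ℝ ↦ C * M * t ^ (-(3 / 2) : ℝ)) (Ioi x) :=
    (integrableOn_Ioi_rpow_of_lt (by norm_num) hx0).const_mul _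
  refine hb.mono' ?_ ((ae_restrict_iff' measurableSet_Ioi).2 (ae_of_all _ fun t ht ↦ ?_))
  · exact (continuous_Rone.continuousOn.mul (continuousOn_w0'.mono fun t ht ↦ hx.trans ht)).aestronglyMeasurable
      measurableSet_Ioi
  · have ht0 : 0 < t := hx0.trans ht
    rw [Real.norm_eq_abs, abs_mul]
    have h1 := hC t ht.le
    have h2 := abs_w0'_le hx ht.le
    have hlx : 0 < Real.log x := Real.log_pos hx
    have hM0 : 0 ≤ M := by positivity
    calc |Rone t| * |w0' t| ≤ (C * t ^ (3 / 2 : ℝ)) * (M / t ^ 3) :=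
          mul_le_mul h1 h2 (abs_nonneg _) (by positivity)
      _ = C * M * t ^ (-(3 / 2) : ℝ) := by
          rw [Real.rpow_neg ht0.le, show (t ^ 3 : ℝ) = t ^ (3 / 2 : ℝ) * t ^ (3 / 2 : ℝ) by
            rw [← Real.rpow_add ht0]; norm_num]
          have : (t ^ (3 / 2 : ℝ)) ≠ 0 := (Real.rpow_pos_of_pos ht0 _).ne'
          field_simp

/-- **The improper integral (1.16) converges to `nicolasJ x`**: if `|R₁(t)| ≤ C t^{3/2}` for
`t ≥ x > 1` then `∫_x^X (ψ(t) − t) w₀(t) dt → J(x)` as `X → ∞`. [cite: Nicolas2012, (1.16)] -/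
theorem tendsto_integral_R_mul_w0 {x C : ℝ} (hx : 1 < x) (hC : ∀ t, x ≤ t → |Rone t| ≤ C * t ^ (3 / 2 : ℝ)) :
    Tendsto (fun X : ℝ ↦ ∫ t in x..X, (ψ t - t) * w0 t) atTop (𝓝 (nicolasJ x)) := by
  have hx0 : 0 < x := by linarith
  have hlx : 0 < Real.log x := Real.log_pos hx
  have hC0 : 0 ≤ C := by
    have := hC x le_rfl
    have h1 : 0 < x ^ (3 / 2 : ℝ) := Real.rpow_pos_of_pos hx0 _
    nlinarith [abs_nonneg (Rone x)]
  -- the boundary term at `X` tends to `0`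
  have hbdry : Tendsto (fun X : ℝ ↦ Rone X * w0 X) atTop (𝓝 0) := by
    have hmaj : Tendsto (fun X : ℝ ↦ C * (1 / Real.log x + 1 / Real.log x ^ 2) * X ^ (-(1 / 2) : ℝ))
        atTop (𝓝 0) := by
      have h := (tendsto_rpow_neg_atTop (y := (1 / 2 : ℝ)) (by norm_num)).const_mul
        (C * (1 / Real.log x + 1 / Real.log x ^ 2))
      rw [mul_zero] at h
      exact h
    refine squeeze_zero_norm' ?_ hmaj
    filter_upwards [eventually_ge_atTop x] with X hX
    have hX0 : 0 < X := hx0.trans_le hX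
    rw [Real.norm_eq_abs, abs_mul, abs_of_pos (w0_pos (hx.trans_le hX))]
    calc |Rone X| * w0 X ≤ (C * X ^ (3 / 2 : ℝ)) * ((1 / Real.log x + 1 / Real.log x ^ 2) / X ^ 2) :=
          mul_le_mul (hC X hX) (w0_le hx hX) (w0_pos (hx.trans_le hX)).le (by positivity)
      _ = C * (1 / Real.log x + 1 / Real.log x ^ 2) * X ^ (-(1 / 2) : ℝ) := by
          rw [show (X ^ 2 : ℝ) = X ^ (3 / 2 : ℝ) * X ^ (1 / 2 : ℝ) by rw [← Real.rpow_add hX0]; norm_num,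
            Real.rpow_neg hX0.le]
          have : X ^ (3 / 2 : ℝ) ≠ 0 := (Real.rpow_pos_of_pos hX0 _).ne'
          have : X ^ (1 / 2 : ℝ) ≠ 0 := (Real.rpow_pos_of_pos hX0 _).ne'
          field_simp
  -- the integral term converges
  have hint := intervalIntegral_tendsto_integral_Ioi x (integrableOn_Rone_mul_w0' hx hC) tendsto_id
  have hlim := (hbdry.sub (tendsto_const_nhds (x := Rone x * w0 x))).sub hint
  have heq : (0 - Rone x * w0 x - ∫ t in Ioi x, Rone t * w0' t) = nicolasJ x := by rw [nicolasJ]; ring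
  rw [← heq]
  refine hlim.congr' ?_
  filter_upwards [eventually_ge_atTop x] with X hX
  simp only [id]
  rw [integral_R_mul_w0_eq hx hX]

end NicolasJ

end Literature.NumberTheory.LFunctions

end
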